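import Literature.Probability.RandomPlanarGeometry.SAWStripTM
import HarnessLib

/-!
# The strip transfer matrix at a general fugacity `num/den` and scale `S` (definitions)

Topic `Literature/Probability/RandomPlanarGeometry` (continues `SAWStripTM.lean`). The certified
lower bound `2.6 ≤ μ(ℤ²)` (`SAWLowerBound.lean`) evaluates Kesten's irreducible-bridge Kraft sum
with the frontier transfer matrix of `SAWStripTM.lean`, whose weight layer hard-codes the fugacity
`5/13 = 1/2.6` (`StripTM.fug`) and the fixed-point scale `2⁶⁴` (`StripTM.SCALE`). To certify any
bound `ρ ≤ μ` with `ρ > 2.6` by the same method (Jensen 2004, §2: the reciprocal of the solution of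
`Σ_{n ≤ N} Σ_{l ≤ L} a_{n,l} xⁿ = 1` is a lower bound on `μ`, improving with the span cut-off `L`)
one needs the Kraft sum at the fugacity `x = 1/ρ`. This file is the weight layer with the fugacity
`num/den` and the scale `S` as parameters; the automaton (`StripTM.step`, signatures, traces,
decoding) is the tree's, unchanged, so the soundness chain `SAWStripTMTraces` … `SAWStripTMDecode`
applies verbatim and only the fixed-point invariant is re-proved (`SAWStripTMAtBound.lean`).

* `StripTM.fugAt num den w = ⌊w · num / den⌋`;
* `StripTM.addChoiceAt`, `layerOfListAt`, `layerAt`, `runFromAt` — the layer sweep of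
  `SAWStripTM.lean` with `fug` replaced by `fugAt num den`;
* `StripTM.dpAt num den S l H r₀` — `S ×` (a lower bound, by rounding down, of) the sum of
  `(num/den)^{|s|}` over the irreducible bridges `s` of span `l` decoded from the accepted traces of
  the `l × H` grid with start row `r₀`. Only ever evaluated by `native_decide`
  (`SAWStripTMAtEval*.lean`). `dpAt 5 13 (2^64) = dp` definitionally up to unfolding.

## References

* I. Jensen, *Improved lower bounds on the connective constants for two-dimensional self-avoiding
  walks*, J. Phys. A 37 (2004) 11521–11529, §2, eq. (3)–(4) [Jensen2004SAWLowerBounds].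
* S. E. Alm, R. Parviainen, *Bounds for the connective constant of the hexagonal lattice*,
  J. Phys. A 37 (2004) 549–560.
-/

namespace Literature.Probability.RandomPlanarGeometry.SAW

namespace StripTM

variable (num den : ℕ) (l r0 : ℕ)

/-- Multiply a fixed-point weight by the fugacity `num/den`, rounding down.
[cite: Jensen2004SAWLowerBounds, §2] -/
def fugAt (w : ℕ) : ℕ := w * num / den

/-- Process one (signature, weight) pair for the choice `e` at micro-step `u` at fugacity
`num/den`: extend the next layer or add a completed block (with the extra factor `num/den` of the
initial step) to the accumulator. [cite: Jensen2004SAWLowerBounds, §2.1] -/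
def addChoiceAt (u : ℕ) (σ : State) (w : ℕ) (e : Bool) (p : Std.HashMap State ℕ × ℕ) :
    Std.HashMap State ℕ × ℕ :=
  let w' := if e then fugAt num den w else w
  match step l r0 u σ e with
  | .dead => p
  | .complete => (p.1, p.2 + fugAt num den w')
  | .next σ' => (p.1.alter σ' fun o => some (o.getD 0 + w'), p.2)

/-- Build the next layer from a list of (signature, weight) pairs, fugacity `num/den`.
[cite: Jensen2004SAWLowerBounds, §2.1] -/
def layerOfListAt (u : ℕ) (entries : List (State × ℕ)) (acc : ℕ) : Std.HashMap State ℕ × ℕ :=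
  entries.foldl (fun p sw => addChoiceAt num den l r0 u sw.1 sw.2 true
      (addChoiceAt num den l r0 u sw.1 sw.2 false p))
    (Std.HashMap.emptyWithCapacity 4096, acc)

/-- One micro-step of the weighted count at fugacity `num/den`. [cite: Jensen2004SAWLowerBounds, §2.1] -/
def layerAt (u : ℕ) (p : Std.HashMap State ℕ × ℕ) : Std.HashMap State ℕ × ℕ :=
  layerOfListAt num den l r0 u p.1.toList p.2

/-- Run the micro-steps `u, u+1, …, u+n-1` at fugacity `num/den`. [cite: Jensen2004SAWLowerBounds, §2.1] -/
def runFromAt (u n : ℕ) (p : Std.HashMap State ℕ × ℕ) : Std.HashMap State ℕ × ℕ :=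
  match n with
  | 0 => p
  | n + 1 => runFromAt (u + 1) n (layerAt num den l r0 u p)

/-- **The certified quantity** `dpAt num den S l H r₀`: `S ×` (a lower bound, by rounding down,
of) the sum of `(num/den)^{|s|}` over the irreducible bridges `s` of span `l` decoded from the
accepted traces of the `l × H` grid with start row `r₀` (initial weight `S`, the fixed-point
scale). Only ever evaluated by `native_decide`. [cite: Jensen2004SAWLowerBounds, §2, eq. (4)] -/
def dpAt (S : ℕ) (H : ℕ) : ℕ :=
  (runFromAt num den l r0 0 (2 * l * H) ((Std.HashMap.emptyWithCapacity 16).insert (initState l) S, 0)).2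

end StripTM

end Literature.Probability.RandomPlanarGeometry.SAW
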